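/-
Copyright (c) 2026 the pub-hodgecm-mathlib formalisation cell (harness21).  Prover seat hodgecm-mathlib-F0P2-p01 (g14), 2026-09-01.  Road «S3-tree», LIFT — the BOUNDARY PIECE
`h` (architect A-p16 (g30) A-111 ∕ A-122 ∕ A-124): a level-1 `K`-class piece with PRESCRIBED values on the residual Jordan strata of `K`.
-/
import Literature.NumberTheory.Automorphic.UnitaryLevelTwoLiftPieces            -- ★ p846479 (this lineage): `isLocSmooth_of_level_invariant_of_support_subset`, `mem_cmLocalIntegralLevel_of_level`, `coe_localNonsplitEquiv_conj'`∕`_mul`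
import Literature.NumberTheory.Automorphic.UnitaryDepthZeroPieceOrbitalIntegral  -- ★ A-p12: `rank_redMat_conj_sub_one_eq`, `redMat_coe_mul_of_mem_glInt`
import Literature.NumberTheory.Automorphic.ResiduallyTrivialFixedCosetCount      -- ★ A-p12 ROW-0: `rank_redMat_sub_one_eq_zero_iff_forall_valuation_le`
import Literature.NumberTheory.Automorphic.LocalUnitaryIntegralLevel             -- ★ `mem_localIntegralLevel_iff_of_smul_eq`
import Literature.NumberTheory.Automorphic.Liu2021.LemD1AsPrintedIndexedNonVacuityInertCofinite  -- ★ `valued_toPlace_uniformizer_of_isUnramifiedIn`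
import Literature.NumberTheory.Automorphic.ValuedFieldValuativeRelBridge         -- ★ `isUniformizingElement_of_v_eq`, `v_le_iff_valuation_le`
import HarnessLib

/-!
# LIFT boundary piece: the level-one `K`-class piece of the residual Jordan strata (road «S3-tree», organ (B) of `liftOneTwo`; Rogawski 1990 §4.9, Kottwitz 1986 §3)

Topic `NumberTheory/Automorphic`; namespace `Literature.NumberTheory.Automorphic`.  THEOREMS ONLY (no definition, no instance, no notation, no named fact, no `sorry`).
Cell `pub/hodgecm-mathlib` (D-0151), crux H413 = `stmt-HodgeConjecture-24833`; road «S3-tree» (architect A-p16 (g30) A-105 ∕ A-111 ∕ A-121 ∕ A-122 ∕ A-124; END F0P3a-p03 (g15)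
fold v3.1 `LocalTransferAtOneHyperspecialLevelTwo.fold.v3.1` 32024a35ce8b5797, organ (B) `stub_liftBoundary` :420, holder F0P3a-p06 (g14), who imports THIS lemma by name for
the `∃ h` of (B)).  Seat F0P2-p01 (g14).  HONEST LABEL: HC_CM is proved only modulo the 2 remaining named inputs (hLiu418 24832, h413 24833) until rung 0 closes; this file is
unconditional local algebra ∕ topology on `U(H′)(L⁺_v)` and asserts nothing printed about the transfer.

THE SETTING (tokens of (B) VERBATIM): `G = (cmDatum L 3 H′).Local v` at a non-split `v` unramified in the CM field `L` (`w ∣ v`, `σ • w = w`), `K = cmLocalIntegralLevel L 3 H′ v`,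
`e = localNonsplitEquiv σ H′ _ w hw : G ≃* U(σ_w, H′_w)(L_w)` the one-place model, `ϖ_v` the tree's uniformiser of `L⁺_v` read in `L_w` (`toPlace v w ϖ_v`, a uniformiser of
`L_w` since `v` is unramified ★ `valued_toPlace_uniformizer_of_isUnramifiedIn`), `k_w := (k.val).val.map (eval at w)` (`= ↑(e k)` definitionally, ★ `coe_localNonsplitEquiv_apply`),
`red = redMat` the entrywise residue map, and «`u_w ≡ 1 (mod ϖ)`» spelled `∀ a b, |(ϖ_v ^ 1)⁻¹ · ((e u)_{ab} − 1_{ab})| ≤ 1` (A-69 (β) at `j = 1`).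

THE MATHEMATICS ([Rogawski1990, §4.9 p. 54: the pieces on the hyperspecial `K`]; [Kottwitz1986, §3]).  Given ANY value table `c : ℕ → ℂ`, put
`h x := c (rank (red x_w − 1))` for `x ∈ K` and `h x := 0` off `K`.  Then:
* `h` is left-invariant under the level-1 congruence set `K(1) = {u : u_w ≡ 1 (ϖ)}`: such `u` lie in `K` (★ `mem_cmLocalIntegralLevel_of_level`) and have `red u_w = 1`
  (★ ROW-0 `rank_redMat_sub_one_eq_zero_iff_forall_valuation_le`), so `red (ux)_w = red u_w · red x_w = red x_w` (★ `redMat_coe_mul_of_mem_glInt`);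
* `h` is `Ad K`-invariant: `rank (red (uxu⁻¹)_w − 1) = rank (red x_w − 1)` for `u, x ∈ K` (★ `rank_redMat_conj_sub_one_eq` — conjugation by the residually invertible `red u_w`);
* `h` is `IsLocSmooth` with `tsupport h ⊆ K` (★ `isLocSmooth_of_level_invariant_of_support_subset`: `K(1)` is open, `K` is compact open);
* on a residually-unipotent `k ∈ K` of Jordan rank `r`, `h k = c r` by definition (in fact on every `k ∈ K`; the nilpotency guard of (B) is not needed).
So `h` is the LEVEL-1 STRATA PIECE with values `c` that organ (B) splits off a level-2 piece on the boundary of a 2-deep class (A-105: values `c 1, c 2` on the residual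
transvections ∕ residually regular unipotents, `c 0 = 0` on `K(1)` — the latter is organ (V)'s normalisation, not a hypothesis here).

* plumbing (one-place model `e`, `N = 3`): `coe_localNonsplitEquiv_mem_glInt_of_mem` (`K ⊆ e⁻¹GL₃(𝒪_w)`), `rank_redMat_localNonsplitEquiv_conj_sub_one_eq` (`Ad K` keeps the
  residual Jordan rank), `mem_and_redMat_coe_eq_one_of_levelOne` (`u_w ≡ 1 (ϖ_v)` ⇒ `u ∈ K ∧ red (e u) = 1`), `redMat_coe_mul_eq_of_levelOne` (`red (e (ux)) = red (e x)`);
* **`exists_levelOne_piece_boundary`** — THE LEMMA (A-124 text): `∃ h`, `IsLocSmooth h ∧ tsupport h ⊆ K ∧ (Ad K-invariance) ∧ (level-1 left-invariance) ∧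
  ∀ k ∈ K, (red k_w − 1)³ = 0 → h k = c (rank (red k_w − 1))`.

## References
* [Rogawski1990] J. D. Rogawski, *Automorphic Representations of Unitary Groups in Three Variables*, Ann. of Math. Stud. 123 (1990): §4.9 p. 54 (functions on the
  hyperspecial `K` constant on residual strata), §1.6 p. 6 (`C_c^∞`).
* [Kottwitz1986] R. E. Kottwitz, *Base change for unit elements of Hecke algebras*, Compositio Math. 60 (1986): §3 (congruence filtration, reduction of `K`).
* [BernsteinZelevinsky1976] I. N. Bernstein, A. V. Zelevinsky, Russian Math. Surveys 31 (1976): §1.1 (locally constant compactly supported functions).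
* [PlatonovRapinchuk1994] V. Platonov, A. Rapinchuk, *Algebraic Groups and Number Theory* (1994): §3.3 (reduction `G_𝒪 → G_𝓀`), §5.1.
-/

set_option autoImplicit false

noncomputable section

open scoped Matrix MatrixGroups Topology
open Set NumberField IsDedekindDomain Matrix

namespace Literature.NumberTheory.Automorphic

open UnitaryGroup IntegralReduction Literature.NumberTheory.GaloisRepresentations Literature.NumberTheory.Rogawski1990
  Literature.NumberTheory.Automorphic.UnitaryLatticeTree

section Plumbing

variable (L : Type) [Field L] [NumberField L] [IsCMField L] (H' : Matrix (Fin 3) (Fin 3) L)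
  {v : HeightOneSpectrum (𝓞 ↥(maximalRealSubfield L))}
  (w : UnitaryGroup.PlacesOver L v) (hw : IsCMField.complexConj L • w.1 = w.1)

/-- `K ⊆ e⁻¹ GL₃(𝒪_w)`: the one-place image of an element of the hyperspecial `K` is an integral unit (★ `mem_localIntegralLevel_iff_of_smul_eq`).
[cite: PlatonovRapinchuk1994, §5.1] -/
theorem coe_localNonsplitEquiv_mem_glInt_of_mem {x : (cmDatum L 3 H').Local v} (hx : x ∈ cmLocalIntegralLevel L 3 H' v) :
    ((localNonsplitEquiv (IsCMField.complexConj L) H' (IsCMField.complexConj_ne_one L) w hw x :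
        ↥(unitaryGroupOfForm (galAdicCompletionMap (L := L) (IsCMField.complexConj L) hw) (placeForm H' w.1))) : GL (Fin 3) (w.1.adicCompletion L)) ∈ glInt 3 (w.1.adicCompletion L) :=
  (mem_localIntegralLevel_iff_of_smul_eq (IsCMField.complexConj L) 3 H' (IsCMField.complexConj_ne_one L) w hw x).1 hx

/-- **`Ad K` does not change the residual Jordan rank**: `rank (red (uxu⁻¹)_w − 1) = rank (red x_w − 1)` for `u, x ∈ K` (★ A-p12 `rank_redMat_conj_sub_one_eq` at `k = (e u)⁻¹`).
[cite: Kottwitz1986, §3] [cite: Rogawski1990, §4.9 p. 54] -/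
theorem rank_redMat_localNonsplitEquiv_conj_sub_one_eq {u x : (cmDatum L 3 H').Local v} (hu : u ∈ cmLocalIntegralLevel L 3 H' v) (hx : x ∈ cmLocalIntegralLevel L 3 H' v) :
    (redMat (((localNonsplitEquiv (IsCMField.complexConj L) H' (IsCMField.complexConj_ne_one L) w hw (u * x * u⁻¹) :
        ↥(unitaryGroupOfForm (galAdicCompletionMap (L := L) (IsCMField.complexConj L) hw) (placeForm H' w.1))) : GL (Fin 3) (w.1.adicCompletion L)) :
          Matrix (Fin 3) (Fin 3) (w.1.adicCompletion L)) - 1).rank =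
      (redMat (((localNonsplitEquiv (IsCMField.complexConj L) H' (IsCMField.complexConj_ne_one L) w hw x :
        ↥(unitaryGroupOfForm (galAdicCompletionMap (L := L) (IsCMField.complexConj L) hw) (placeForm H' w.1))) : GL (Fin 3) (w.1.adicCompletion L)) :
          Matrix (Fin 3) (Fin 3) (w.1.adicCompletion L)) - 1).rank := by
  have huI := coe_localNonsplitEquiv_mem_glInt_of_mem L H' w hw hu
  have hxI := coe_localNonsplitEquiv_mem_glInt_of_mem L H' w hw hx
  have key := rank_redMat_conj_sub_one_eq (inv_mem huI) hxI
  rw [inv_inv] at key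
  rw [coe_localNonsplitEquiv_conj' L 3 H' (IsCMField.complexConj_ne_one L) w hw u x]
  exact key

/-- **The level-1 congruence set lies in `K` and reduces to `1`**: `|(ϖ_v)⁻¹((e u)_{ab} − 1_{ab})| ≤ 1` for all `a, b` (with `v` unramified, so `ϖ_v` is a uniformiser of `L_w`)
gives `u ∈ K` (★ `mem_cmLocalIntegralLevel_of_level`) and `red (e u) = 1` (★ ROW-0 `rank_redMat_sub_one_eq_zero_iff_forall_valuation_le`). [cite: Kottwitz1986, §3] -/
theorem mem_and_redMat_coe_eq_one_of_levelOne (hv : Algebra.IsUnramifiedIn (𝓞 L) v.asIdeal) {u : (cmDatum L 3 H').Local v}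
    (hu : (∀ a b, Valued.v (((toPlace v w (HeckeCharacter.uniformizer ↥(maximalRealSubfield L) v : v.adicCompletion ↥(maximalRealSubfield L))) ^ 1)⁻¹ *
          ((((localNonsplitEquiv (IsCMField.complexConj L) H' (IsCMField.complexConj_ne_one L) w hw u :
        ↥(unitaryGroupOfForm (galAdicCompletionMap (L := L) (IsCMField.complexConj L) hw) (placeForm H' w.1))) : GL (Fin 3) (w.1.adicCompletion L)) :
          Matrix (Fin 3) (Fin 3) (w.1.adicCompletion L)) a b - (1 : Matrix (Fin 3) (Fin 3) (w.1.adicCompletion L)) a b)) ≤ 1)) :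
    u ∈ cmLocalIntegralLevel L 3 H' v ∧ redMat (((localNonsplitEquiv (IsCMField.complexConj L) H' (IsCMField.complexConj_ne_one L) w hw u :
        ↥(unitaryGroupOfForm (galAdicCompletionMap (L := L) (IsCMField.complexConj L) hw) (placeForm H' w.1))) : GL (Fin 3) (w.1.adicCompletion L)) :
          Matrix (Fin 3) (Fin 3) (w.1.adicCompletion L)) = 1 := by
  have hϖv := Liu2021.LemD1IndexedNonVacuityInertCofinite.valued_toPlace_uniformizer_of_isUnramifiedIn L v hv w
  have hvϖ0 : Valued.v (toPlace v w (HeckeCharacter.uniformizer ↥(maximalRealSubfield L) v : v.adicCompletion ↥(maximalRealSubfield L))) ≠ 0 := by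
    rw [hϖv]; exact WithZero.coe_ne_zero
  have hϖ0 : (toPlace v w (HeckeCharacter.uniformizer ↥(maximalRealSubfield L) v : v.adicCompletion ↥(maximalRealSubfield L))) ≠ 0 := (Valuation.ne_zero_iff _).1 hvϖ0
  have hϖ1 : Valued.v (toPlace v w (HeckeCharacter.uniformizer ↥(maximalRealSubfield L) v : v.adicCompletion ↥(maximalRealSubfield L))) < 1 := by
    rw [hϖv, ← WithZero.exp_zero]; exact WithZero.exp_lt_exp.2 (by norm_num)
  have hϖu : IsUniformizingElement (toPlace v w (HeckeCharacter.uniformizer ↥(maximalRealSubfield L) v : v.adicCompletion ↥(maximalRealSubfield L))) := isUniformizingElement_of_v_eq hϖv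
  have huK : u ∈ cmLocalIntegralLevel L 3 H' v :=
    mem_cmLocalIntegralLevel_of_level L 3 H' (IsCMField.complexConj_ne_one L) w hw hϖ0 hϖ1 (le_refl 1) u (fun a b => hu a b)
  have huI := coe_localNonsplitEquiv_mem_glInt_of_mem L H' w hw huK
  refine ⟨huK, ?_⟩
  have hrank0 : (redMat (((localNonsplitEquiv (IsCMField.complexConj L) H' (IsCMField.complexConj_ne_one L) w hw u :
        ↥(unitaryGroupOfForm (galAdicCompletionMap (L := L) (IsCMField.complexConj L) hw) (placeForm H' w.1))) : GL (Fin 3) (w.1.adicCompletion L)) :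
          Matrix (Fin 3) (Fin 3) (w.1.adicCompletion L)) - 1).rank = 0 := by
    refine (rank_redMat_sub_one_eq_zero_iff_forall_valuation_le hϖu huI).2 fun a b => (v_le_iff_valuation_le _ _).1 ?_
    have hab := hu a b
    rw [pow_one, Valuation.map_mul, map_inv₀, ← Matrix.sub_apply] at hab
    calc Valued.v (((((localNonsplitEquiv (IsCMField.complexConj L) H' (IsCMField.complexConj_ne_one L) w hw u :
        ↥(unitaryGroupOfForm (galAdicCompletionMap (L := L) (IsCMField.complexConj L) hw) (placeForm H' w.1))) : GL (Fin 3) (w.1.adicCompletion L)) :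
          Matrix (Fin 3) (Fin 3) (w.1.adicCompletion L)) - 1) a b)
        = Valued.v (toPlace v w (HeckeCharacter.uniformizer ↥(maximalRealSubfield L) v : v.adicCompletion ↥(maximalRealSubfield L))) *
            ((Valued.v (toPlace v w (HeckeCharacter.uniformizer ↥(maximalRealSubfield L) v : v.adicCompletion ↥(maximalRealSubfield L))))⁻¹ *
              Valued.v (((((localNonsplitEquiv (IsCMField.complexConj L) H' (IsCMField.complexConj_ne_one L) w hw u :
        ↥(unitaryGroupOfForm (galAdicCompletionMap (L := L) (IsCMField.complexConj L) hw) (placeForm H' w.1))) : GL (Fin 3) (w.1.adicCompletion L)) :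
          Matrix (Fin 3) (Fin 3) (w.1.adicCompletion L)) - 1) a b)) := by
          rw [← mul_assoc, mul_inv_cancel₀ hvϖ0, one_mul]
      _ ≤ Valued.v (toPlace v w (HeckeCharacter.uniformizer ↥(maximalRealSubfield L) v : v.adicCompletion ↥(maximalRealSubfield L))) * 1 := mul_le_mul_right hab _
      _ = Valued.v (toPlace v w (HeckeCharacter.uniformizer ↥(maximalRealSubfield L) v : v.adicCompletion ↥(maximalRealSubfield L))) := mul_one _
  have h0 := (rank_eq_zero_iff_eq_zero _).1 hrank0
  rwa [sub_eq_zero] at h0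

/-- **Left translation by the level-1 congruence set does not change the residual reduction**: `red (e (ux)) = red (e x)` for `x ∈ K` and `u_w ≡ 1 (mod ϖ_v)`
(★ `redMat_coe_mul_of_mem_glInt`). [cite: Kottwitz1986, §3] -/
theorem redMat_coe_mul_eq_of_levelOne (hv : Algebra.IsUnramifiedIn (𝓞 L) v.asIdeal) {u x : (cmDatum L 3 H').Local v}
    (hu : (∀ a b, Valued.v (((toPlace v w (HeckeCharacter.uniformizer ↥(maximalRealSubfield L) v : v.adicCompletion ↥(maximalRealSubfield L))) ^ 1)⁻¹ *
          ((((localNonsplitEquiv (IsCMField.complexConj L) H' (IsCMField.complexConj_ne_one L) w hw u :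
        ↥(unitaryGroupOfForm (galAdicCompletionMap (L := L) (IsCMField.complexConj L) hw) (placeForm H' w.1))) : GL (Fin 3) (w.1.adicCompletion L)) :
          Matrix (Fin 3) (Fin 3) (w.1.adicCompletion L)) a b - (1 : Matrix (Fin 3) (Fin 3) (w.1.adicCompletion L)) a b)) ≤ 1))
    (hx : x ∈ cmLocalIntegralLevel L 3 H' v) :
    redMat (((localNonsplitEquiv (IsCMField.complexConj L) H' (IsCMField.complexConj_ne_one L) w hw (u * x) :
        ↥(unitaryGroupOfForm (galAdicCompletionMap (L := L) (IsCMField.complexConj L) hw) (placeForm H' w.1))) : GL (Fin 3) (w.1.adicCompletion L)) :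
          Matrix (Fin 3) (Fin 3) (w.1.adicCompletion L)) = redMat (((localNonsplitEquiv (IsCMField.complexConj L) H' (IsCMField.complexConj_ne_one L) w hw x :
        ↥(unitaryGroupOfForm (galAdicCompletionMap (L := L) (IsCMField.complexConj L) hw) (placeForm H' w.1))) : GL (Fin 3) (w.1.adicCompletion L)) :
          Matrix (Fin 3) (Fin 3) (w.1.adicCompletion L)) := by
  obtain ⟨huK, hred1⟩ := mem_and_redMat_coe_eq_one_of_levelOne L H' w hw hv hu
  rw [coe_localNonsplitEquiv_mul L 3 H' (IsCMField.complexConj_ne_one L) w hw u x,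
    redMat_coe_mul_of_mem_glInt (coe_localNonsplitEquiv_mem_glInt_of_mem L H' w hw huK) (coe_localNonsplitEquiv_mem_glInt_of_mem L H' w hw hx), hred1, Matrix.one_mul]

end Plumbing

/-- **THE LEVEL-1 STRATA PIECE WITH PRESCRIBED VALUES** (road «S3-tree», LIFT boundary piece `h`, architect A-111 ∕ A-124; consumed by organ (B) `stub_liftBoundary`):
at a non-split place `v` unramified in the CM field `L` (`w ∣ v`, `σ • w = w`), for every value table `c : ℕ → ℂ` there is `h : U(H′)(L⁺_v) → ℂ` which is `IsLocSmooth`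
with `tsupport h ⊆ K = U(H′)(𝒪_v)`, `Ad K`-invariant, left-invariant under the level-1 congruence set «`u_w ≡ 1 (mod ϖ_v)`», and takes the value `c (rank (red k_w − 1))`
at every residually-unipotent `k ∈ K` — namely `h = 1_K · (c ∘ rank ∘ (red(·)_w − 1))`. [cite: Rogawski1990, §4.9 p. 54] [cite: Kottwitz1986, §3]
[cite: BernsteinZelevinsky1976, §1.1] -/
theorem exists_levelOne_piece_boundary
    (L : Type) [Field L] [NumberField L] [IsCMField L] (H' : Matrix (Fin 3) (Fin 3) L)
    {v : HeightOneSpectrum (𝓞 ↥(maximalRealSubfield L))}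
    (w : UnitaryGroup.PlacesOver L v) (hw : IsCMField.complexConj L • w.1 = w.1) (hv : Algebra.IsUnramifiedIn (𝓞 L) v.asIdeal)
    (c : ℕ → ℂ) :
    ∃ h : ((cmDatum L 3 H').Local v) → ℂ, Literature.NumberTheory.Rogawski1990.IsLocSmooth h ∧ tsupport h ⊆ (cmLocalIntegralLevel L 3 H' v : Set ((cmDatum L 3 H').Local v)) ∧
      (∀ u ∈ cmLocalIntegralLevel L 3 H' v, ∀ x, h (u * x * u⁻¹) = h x) ∧
      (∀ u : (cmDatum L 3 H').Local v,
        (∀ a b, Valued.v (((toPlace v w (HeckeCharacter.uniformizer ↥(maximalRealSubfield L) v : v.adicCompletion ↥(maximalRealSubfield L))) ^ 1)⁻¹ *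
          ((((localNonsplitEquiv (IsCMField.complexConj L) H' (IsCMField.complexConj_ne_one L) w hw u :
              ↥(unitaryGroupOfForm (galAdicCompletionMap (L := L) (IsCMField.complexConj L) hw) (placeForm H' w.1))) : GL (Fin 3) (w.1.adicCompletion L)) :
                Matrix (Fin 3) (Fin 3) (w.1.adicCompletion L)) a b - (1 : Matrix (Fin 3) (Fin 3) (w.1.adicCompletion L)) a b)) ≤ 1) →
        ∀ x, h (u * x) = h x) ∧
      (∀ k ∈ cmLocalIntegralLevel L 3 H' v,
        (redMat (((k).val : GL (Fin 3) (UnitaryGroup.LocalRing L v)).val.map (Pi.evalRingHom (fun w' : UnitaryGroup.PlacesOver L v => w'.1.adicCompletion L) w)) - 1) ^ 3 = 0 →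
        h k = c (redMat (((k).val : GL (Fin 3) (UnitaryGroup.LocalRing L v)).val.map (Pi.evalRingHom (fun w' : UnitaryGroup.PlacesOver L v => w'.1.adicCompletion L) w)) - 1).rank) := by
  classical
  -- §0 the uniformiser `ϖ_v` read in `L_w` is non-zero
  have hϖv := Liu2021.LemD1IndexedNonVacuityInertCofinite.valued_toPlace_uniformizer_of_isUnramifiedIn L v hv w
  have hϖ0 : (toPlace v w (HeckeCharacter.uniformizer ↥(maximalRealSubfield L) v : v.adicCompletion ↥(maximalRealSubfield L))) ≠ 0 := by
    refine (Valuation.ne_zero_iff Valued.v).1 ?_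
    rw [hϖv]; exact WithZero.coe_ne_zero
  -- §1 the piece: `h = 1_K · c ∘ rank ∘ (red(·)_w − 1)` (the `(k.val).val.map (eval w)` spelling of (B); `= ↑(e k)` definitionally)
  refine ⟨(fun x => if x ∈ cmLocalIntegralLevel L 3 H' v then c (redMat (((x).val : GL (Fin 3) (UnitaryGroup.LocalRing L v)).val.map (Pi.evalRingHom (fun w' : UnitaryGroup.PlacesOver L v => w'.1.adicCompletion L) w)) - 1).rank else 0), ?_⟩
  -- §2 level-1 left-invariance
  have h1 : ∀ u : (cmDatum L 3 H').Local v,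
      (∀ a b, Valued.v (((toPlace v w (HeckeCharacter.uniformizer ↥(maximalRealSubfield L) v : v.adicCompletion ↥(maximalRealSubfield L))) ^ 1)⁻¹ *
          ((((localNonsplitEquiv (IsCMField.complexConj L) H' (IsCMField.complexConj_ne_one L) w hw u :
        ↥(unitaryGroupOfForm (galAdicCompletionMap (L := L) (IsCMField.complexConj L) hw) (placeForm H' w.1))) : GL (Fin 3) (w.1.adicCompletion L)) :
          Matrix (Fin 3) (Fin 3) (w.1.adicCompletion L)) a b - (1 : Matrix (Fin 3) (Fin 3) (w.1.adicCompletion L)) a b)) ≤ 1) →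
      ∀ x, (fun x => if x ∈ cmLocalIntegralLevel L 3 H' v then c (redMat (((x).val : GL (Fin 3) (UnitaryGroup.LocalRing L v)).val.map (Pi.evalRingHom (fun w' : UnitaryGroup.PlacesOver L v => w'.1.adicCompletion L) w)) - 1).rank else 0) (u * x) = (fun x => if x ∈ cmLocalIntegralLevel L 3 H' v then c (redMat (((x).val : GL (Fin 3) (UnitaryGroup.LocalRing L v)).val.map (Pi.evalRingHom (fun w' : UnitaryGroup.PlacesOver L v => w'.1.adicCompletion L) w)) - 1).rank else 0) x := by
    intro u hu x
    have huK := (mem_and_redMat_coe_eq_one_of_levelOne L H' w hw hv hu).1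
    by_cases hx : x ∈ cmLocalIntegralLevel L 3 H' v
    · have hux : u * x ∈ cmLocalIntegralLevel L 3 H' v := mul_mem huK hx
      have hred := redMat_coe_mul_eq_of_levelOne L H' w hw hv hu hx
      simp only [hx, hux, if_true]
      exact congrArg (fun M : Matrix (Fin 3) (Fin 3) _ => c (M - 1).rank) hred
    · have hux : u * x ∉ cmLocalIntegralLevel L 3 H' v := fun h => hx (by
        have h' := mul_mem (inv_mem huK) h
        rwa [inv_mul_cancel_left] at h')
      simp only [hx, hux, if_false]
  -- §3 `Ad K`-invariance
  have h2 : ∀ u ∈ cmLocalIntegralLevel L 3 H' v, ∀ x, (fun x => if x ∈ cmLocalIntegralLevel L 3 H' v then c (redMat (((x).val : GL (Fin 3) (UnitaryGroup.LocalRing L v)).val.map (Pi.evalRingHom (fun w' : UnitaryGroup.PlacesOver L v => w'.1.adicCompletion L) w)) - 1).rank else 0) (u * x * u⁻¹) = (fun x => if x ∈ cmLocalIntegralLevel L 3 H' v then c (redMat (((x).val : GL (Fin 3) (UnitaryGroup.LocalRing L v)).val.map (Pi.evalRingHom (fun w' : UnitaryGroup.PlacesOver L v => w'.1.adicCompletion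 L) w)) - 1).rank else 0) x := by
    intro u hu x
    by_cases hx : x ∈ cmLocalIntegralLevel L 3 H' v
    · have hux : u * x * u⁻¹ ∈ cmLocalIntegralLevel L 3 H' v := mul_mem (mul_mem hu hx) (inv_mem hu)
      have hrk := rank_redMat_localNonsplitEquiv_conj_sub_one_eq L H' w hw hu hx
      simp only [hx, hux, if_true]
      exact congrArg c hrk
    · have hux : u * x * u⁻¹ ∉ cmLocalIntegralLevel L 3 H' v := fun h => hx (by
        have h' := mul_mem (mul_mem (inv_mem hu) h) hu
        rwa [← mul_assoc, ← mul_assoc, inv_mul_cancel, one_mul, inv_mul_cancel_right] at h')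
      simp only [hx, hux, if_false]
  -- §4 smoothness and support (★ p846479: the level-1 set is open, `K` is compact open)
  have h3 := isLocSmooth_of_level_invariant_of_support_subset L 3 H' (IsCMField.complexConj_ne_one L) w hw hϖ0 1
    (fun x => if x ∈ cmLocalIntegralLevel L 3 H' v then c (redMat (((x).val : GL (Fin 3) (UnitaryGroup.LocalRing L v)).val.map (Pi.evalRingHom (fun w' : UnitaryGroup.PlacesOver L v => w'.1.adicCompletion L) w)) - 1).rank else 0) (fun U hU => h1 U hU)
    (fun x hx => by
      by_contra hxK
      exact hx (if_neg hxK))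
  exact ⟨h3.1, h3.2, h2, h1, fun k hk _ => if_pos hk⟩

end Literature.NumberTheory.Automorphic

end
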